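import Literature.Probability.LatticeModels.IsingEdwardsSokalCoupling
import Literature.Probability.LatticeModels.IsingAnnulusCircuitGeometry
import Literature.Probability.LatticeModels.IsingBoundaryMonotonicity
import Literature.Probability.LatticeModels.PlanarIsing
import HarnessLib

/-!
# RSW for the critical planar Ising model: a `−` circuit under `+` boundary conditions

Topic `Literature/Probability/LatticeModels` (family `crit-ising`). The spin-side conclusion of
the transfer of the RSW theory of the critical FK-Ising model to the critical Ising model on `ℤ²`
through the Edwards–Sokal coupling (Chelkak–Duminil-Copin–Hongler, Electron. J. Probab. 21 (2016),
§5.3, proof of Cor. 1.7; Chelkak–Duminil-Copin–Hongler–Kemppainen–Smirnov, C. R. Math. 352 (2014),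
Rem. 4; Kemppainen–Smirnov, Ann. Probab. 45 (2017), Rem. 2.10: "under positive association the
sufficient condition … is a uniform upper bound for the probability of the crossing of an annular
sector with alternating boundary conditions", for which regular annuli suffice):

* `exists_pos_le_isingMeasure_real_minusStarBlocking` — **there is `c' > 0` such that for every
  `x₀ ∈ ℤ²`, every `n ≥ 1` and every boundary condition equal to `+1` on the boundary squares
  `‖x - x₀‖_∞ ∈ {n, 29n}`, the critical Ising measure of the lattice annulus
  `Λ = {n < ‖x - x₀‖_∞ < 29n}` gives probability `≥ c'` to the existence of a set of `-1` spins
  in `Λ` meeting every `∗`-path (king moves) from `{‖x - x₀‖_∞ < 6n}` to `{‖x - x₀‖_∞ > 12n}`**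
  (`minusStarBlocking`; a `−` nearest-neighbour circuit in the language of Georgii–Higuchi 2000,
  §2), assuming the FK inputs `fkIsing_rsw` (DCS Thm. 3.16) and `fkIsing_annulusCrossing_le`
  (DCS Lemma 6.3) — the latter is itself a consequence of the former in the tree
  (`fkInterface_traversalBound_of_fkIsing_rsw`'s companion files), but both are kept as
  hypotheses here;
* `isingMeasure_fixed_real_plusStarCrossing_le` — hence, by monotonicity in the boundary
  condition (`integral_isingMeasure_fixed_mono`), **under every fixed boundary condition the
  probability of a `+∗`-crossing of the annulus `{6n ≤ ‖x - x₀‖_∞ ≤ 12n}` is `≤ 1 - c'`**: the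
  bound "uniform with respect to the worst boundary condition" that drives Condition G for the
  spin-Ising interface (KS 2017, §4; CDHKS 2014, Rem. 4).

Proof of the first statement: Edwards–Sokal with `+` boundary condition
(`isingMeasure_fixed_real_eq_edwardsSokal`): the FK configuration lies in `insulatedCircuitEvent`
with probability `≥ (1 - c)²(min c₁ c₂)⁴` (`le_rcMeasure_real_insulatedCircuitEvent`); on that
event the four seeds of `insulatedCircuitEvent_seeds` are not joined to the wired boundary, so
(the multi-seed coin flip `pow_half_le_colourFrac_of_seeds`, a counting of the cluster
colourings: flipping the cluster of a seed is an injection) with conditional probability `≥ 1/16`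
all their clusters are coloured `-1`, and these clusters block every `∗`-crossing.

## References

* D. Chelkak, H. Duminil-Copin, C. Hongler, Electron. J. Probab. 21 (2016), Cor. 1.7 and §5.3 —
  `ChelkakDuminilCopinHongler2016`.
* D. Chelkak, H. Duminil-Copin, C. Hongler, A. Kemppainen, S. Smirnov, C. R. Math. Acad. Sci.
  Paris 352 (2014), §2 Rem. 4 — `CDHKSCRAS2014`.
* A. Kemppainen, S. Smirnov, Ann. Probab. 45 (2017), Rem. 2.10, §4.1.6 — `KemppainenSmirnov2017`.
* H.-O. Georgii, Y. Higuchi, J. Math. Phys. 41 (2000), §2 — `GeorgiiHiguchi2000`.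
* G. Grimmett, *The Random-Cluster Model* (2006), Thm. 1.13, §4.2 — `Grimmett2006`.
-/

noncomputable section

namespace Literature.Probability.LatticeModels

open Finset SimpleGraph _root_.MeasureTheory Literature.Probability.Percolation

/-! ### The multi-seed coin flip of the Edwards–Sokal coupling -/

section Seeds

variable {V : Type*} [DecidableEq V] {G : SimpleGraph V} [G.LocallyFinite] {Λ : Finset V}

/-- Flipping the spins of the open cluster of `s`. [cite: Grimmett2006, §1.4 Thm. 1.13 (proof)] -/
def flipCluster (ω : Finset (Sym2 (ClosedV G Λ))) (s : ClosedV G Λ) (σ : SpinConfig (ClosedV G Λ)) :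
    SpinConfig (ClosedV G Λ) :=
  open scoped Classical in
  fun v ↦ if (openGraph (↑ω : Percolation.BondConfig (ClosedV G Λ))).Reachable s v then -σ v else σ v

/-- The flip is an involution. [folklore] -/
theorem flipCluster_flipCluster (ω : Finset (Sym2 (ClosedV G Λ))) (s : ClosedV G Λ)
    (σ : SpinConfig (ClosedV G Λ)) : flipCluster ω s (flipCluster ω s σ) = σ := by
  funext v
  by_cases hv : (openGraph (↑ω : Percolation.BondConfig (ClosedV G Λ))).Reachable s v <;>
    simp [flipCluster, hv]

/-- The flip negates the spin at the seed. [folklore] -/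
theorem flipCluster_apply_self (ω : Finset (Sym2 (ClosedV G Λ))) (s : ClosedV G Λ)
    (σ : SpinConfig (ClosedV G Λ)) : flipCluster ω s σ s = -σ s := by
  simp [flipCluster]

/-- The flip does not change spins off the cluster. [folklore] -/
theorem flipCluster_apply_of_not_reachable (ω : Finset (Sym2 (ClosedV G Λ))) {s v : ClosedV G Λ}
    (σ : SpinConfig (ClosedV G Λ))
    (hv : ¬ (openGraph (↑ω : Percolation.BondConfig (ClosedV G Λ))).Reachable s v) :
    flipCluster ω s σ v = σ v := by
  simp [flipCluster, hv]

/-- The flip preserves the compatibility with the open edges. [cite: Grimmett2006, §1.4 Thm. 1.13 (proof)] -/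
theorem flipCluster_compat {ω : Finset (Sym2 (ClosedV G Λ))} (s : ClosedV G Λ)
    {σ : SpinConfig (ClosedV G Λ)} (h : ∀ e ∈ ω, bondSpin σ e = 1) :
    ∀ e ∈ ω, bondSpin (flipCluster ω s σ) e = 1 := by
  set H := openGraph (↑ω : Percolation.BondConfig (ClosedV G Λ)) with hH
  have key : ∀ {a b : ClosedV G Λ}, H.Adj a b → (H.Reachable s a ↔ H.Reachable s b) := fun hab ↦
    ⟨fun h' ↦ h'.trans hab.reachable, fun h' ↦ h'.trans hab.symm.reachable⟩
  rw [forall_bondSpin_eq_one_iff] at h ⊢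
  intro a b hab
  have hab' := h hab
  by_cases ha : H.Reachable s a
  · have hb : H.Reachable s b := (key hab).1 ha
    simp only [flipCluster, ← hH, if_pos ha, if_pos hb, hab']
  · have hb : ¬ H.Reachable s b := fun hb ↦ ha ((key hab).2 hb)
    simp only [flipCluster, ← hH, if_neg ha, if_neg hb, hab']

/-- The flip preserves the plus condition on the wired set if the seed is not joined to it. [folklore] -/
theorem flipCluster_wired {ω : Finset (Sym2 (ClosedV G Λ))} {s : ClosedV G Λ}
    (hs : ¬ ∃ w ∈ esWired G Λ, (openGraph (↑ω : Percolation.BondConfig (ClosedV G Λ))).Reachable s w)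
    {σ : SpinConfig (ClosedV G Λ)} (h : ∀ w ∈ esWired G Λ, σ w = 1) :
    ∀ w ∈ esWired G Λ, flipCluster ω s σ w = 1 := by
  intro w hw
  rw [flipCluster_apply_of_not_reachable ω σ (fun hr ↦ hs ⟨w, hw, hr⟩)]
  exact h w hw

open scoped Classical in
/-- **Counting: each further seed halves at most** (the clusters of the seeds are coloured `-1`
by at least a `2^{-k}` fraction of the plus/cluster-constant configurations): for a finite set
`Sd` of seeds none of which is joined to the wired set,
`#{σ : σ = 1 on ∂, σ constant on clusters, σ = -1 on Sd} · 2^{#Sd} ≥ #{σ : σ = 1 on ∂, σ constant on clusters}`.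
Flipping the cluster of a new seed maps the configurations where it is `+1` injectively into
those where it is `-1`, without touching the earlier seeds (an earlier seed in the same cluster
would have the same spin). [cite: Grimmett2006, §1.4 Thm. 1.13] -/
theorem card_filter_seeds_mul_pow_ge (ω : Finset (Sym2 (ClosedV G Λ))) (Sd : Finset (ClosedV G Λ))
    (hSd : ∀ s ∈ Sd, ¬ ∃ w ∈ esWired G Λ,
      (openGraph (↑ω : Percolation.BondConfig (ClosedV G Λ))).Reachable s w) :
    #(Finset.univ.filter fun σ : SpinConfig (ClosedV G Λ) ↦
        (∀ w ∈ esWired G Λ, σ w = 1) ∧ ∀ e ∈ ω, bondSpin σ e = 1) ≤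
      #(Finset.univ.filter fun σ : SpinConfig (ClosedV G Λ) ↦
        ((∀ w ∈ esWired G Λ, σ w = 1) ∧ ∀ e ∈ ω, bondSpin σ e = 1) ∧ ∀ s ∈ Sd, σ s = -1) * 2 ^ #Sd := by
  induction Sd using Finset.induction_on with
  | empty => simp
  | insert s Sd hs ih =>
    have hSd' : ∀ t ∈ Sd, ¬ ∃ w ∈ esWired G Λ,
        (openGraph (↑ω : Percolation.BondConfig (ClosedV G Λ))).Reachable t w :=
      fun t ht ↦ hSd t (Finset.mem_insert_of_mem ht)
    have hsW := hSd s (Finset.mem_insert_self s Sd)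
    set X := Finset.univ.filter fun σ : SpinConfig (ClosedV G Λ) ↦
      (∀ w ∈ esWired G Λ, σ w = 1) ∧ ∀ e ∈ ω, bondSpin σ e = 1 with hX
    set Xk := Finset.univ.filter fun σ : SpinConfig (ClosedV G Λ) ↦
      ((∀ w ∈ esWired G Λ, σ w = 1) ∧ ∀ e ∈ ω, bondSpin σ e = 1) ∧ ∀ t ∈ Sd, σ t = -1 with hXk
    set A := Finset.univ.filter fun σ : SpinConfig (ClosedV G Λ) ↦
      ((∀ w ∈ esWired G Λ, σ w = 1) ∧ ∀ e ∈ ω, bondSpin σ e = 1) ∧ ∀ t ∈ insert s Sd, σ t = -1 with hA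
    set Bk := Xk.filter fun σ ↦ σ s = 1 with hBk
    -- the flip maps `Bk` into `A`, injectively
    have hmaps : ∀ σ ∈ Bk, flipCluster ω s σ ∈ A := by
      intro σ hσ
      rw [hBk, Finset.mem_filter, hXk, Finset.mem_filter] at hσ
      obtain ⟨⟨-, ⟨hw, hc⟩, hseeds⟩, hσs⟩ := hσ
      rw [hA, Finset.mem_filter]
      refine ⟨Finset.mem_univ _, ⟨flipCluster_wired hsW hw, flipCluster_compat s hc⟩, fun t ht ↦ ?_⟩
      rcases Finset.mem_insert.1 ht with rfl | ht
      · rw [flipCluster_apply_self, hσs]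
      · have hts : ¬ (openGraph (↑ω : Percolation.BondConfig (ClosedV G Λ))).Reachable s t := by
          intro hr
          have heq : σ s = σ t := apply_eq_of_reachable ((forall_bondSpin_eq_one_iff ω σ).1 hc) hr
          rw [hσs, hseeds t ht] at heq
          exact absurd heq (by decide)
        rw [flipCluster_apply_of_not_reachable ω σ hts, hseeds t ht]
    have hinj : Set.InjOn (flipCluster ω s) ↑Bk := fun σ₁ _ σ₂ _ h ↦ by
      rw [← flipCluster_flipCluster ω s σ₁, h, flipCluster_flipCluster]
    have hBA : #Bk ≤ #A := Finset.card_le_card_of_injOn _ hmaps hinj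
    -- `Xk ⊆ A ∪ Bk`
    have hsplit : Xk ⊆ A ∪ Bk := by
      intro σ hσ
      rw [Finset.mem_union]
      rcases Int.units_eq_one_or (σ s) with h1 | h1
      · exact Or.inr (Finset.mem_filter.2 ⟨hσ, h1⟩)
      · refine Or.inl ?_
        rw [hXk, Finset.mem_filter] at hσ
        rw [hA, Finset.mem_filter]
        refine ⟨hσ.1, hσ.2.1, fun t ht ↦ ?_⟩
        rcases Finset.mem_insert.1 ht with rfl | ht
        · exact h1
        · exact hσ.2.2 t ht
    have hXk_le : #Xk ≤ 2 * #A := by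
      calc #Xk ≤ #(A ∪ Bk) := Finset.card_le_card hsplit
        _ ≤ #A + #Bk := Finset.card_union_le _ _
        _ ≤ #A + #A := by omega
        _ = 2 * #A := by ring
    calc #X ≤ #Xk * 2 ^ #Sd := ih hSd'
      _ ≤ (2 * #A) * 2 ^ #Sd := Nat.mul_le_mul_right _ hXk_le
      _ = #A * 2 ^ #(insert s Sd) := by rw [Finset.card_insert_of_notMem hs, pow_succ]; ring

open scoped Classical in
/-- **The multi-seed coin flip, as a bound on the colouring fraction**: if no seed of `Sd` is joined
to the wired set and every compatible interior configuration with spin `-1` at all seeds glues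
into `T`, then `ν_ω(T) ≥ 2^{-#Sd}`. [cite: Grimmett2006, §1.4 Thm. 1.13] -/
theorem pow_half_le_colourFrac_of_seeds {η : SpinConfig V} (hne : (esWired G Λ).Nonempty)
    {T : Set (SpinConfig V)} {ω : Finset (Sym2 (ClosedV G Λ))} (Sd : Finset (ClosedV G Λ))
    (hSd : ∀ s ∈ Sd, ¬ ∃ w ∈ esWired G Λ,
      (openGraph (↑ω : Percolation.BondConfig (ClosedV G Λ))).Reachable s w)
    (hT : ∀ τ : Λ → ℤˣ, (∀ e ∈ ω, bondSpin (plusLift G Λ τ) e = 1) → (∀ s ∈ Sd, plusLift G Λ τ s = -1) →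
      glue Λ τ (.fixed η) ∈ T) :
    (1 / 2 : ℝ) ^ #Sd ≤ colourFrac G Λ η T ω := by
  set X := Finset.univ.filter fun σ : SpinConfig (ClosedV G Λ) ↦
    (∀ w ∈ esWired G Λ, σ w = 1) ∧ ∀ e ∈ ω, bondSpin σ e = 1 with hX
  set A := Finset.univ.filter fun σ : SpinConfig (ClosedV G Λ) ↦
    ((∀ w ∈ esWired G Λ, σ w = 1) ∧ ∀ e ∈ ω, bondSpin σ e = 1) ∧ ∀ s ∈ Sd, σ s = -1 with hA
  -- `#X = 2^{k-1}`
  have hXcard : (#X : ℝ) = (2 : ℝ) ^ (clusterCount (↑ω : Percolation.BondConfig (ClosedV G Λ)) (esWired G Λ) - 1) := by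
    rw [← sum_boole_plus_bondSpin_eq ω hne, hX, Finset.natCast_card_filter]
  -- `esCount ≥ #A`, through `τ ↦ plusLift τ`
  have hinj : Function.Injective (plusLift G Λ : (Λ → ℤˣ) → SpinConfig (ClosedV G Λ)) := by
    intro τ₁ τ₂ h
    funext x
    have hx := congr_fun h ⟨x.1, mem_closedVolume_of_mem x.2⟩
    rw [plusLift_apply_of_mem τ₁ _ x.2, plusLift_apply_of_mem τ₂ _ x.2] at hx
    exact hx
  set A' := Finset.univ.filter fun τ : Λ → ℤˣ ↦
    (∀ e ∈ ω, bondSpin (plusLift G Λ τ) e = 1) ∧ ∀ s ∈ Sd, plusLift G Λ τ s = -1 with hA'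
  have hAA' : A = A'.image (plusLift G Λ) := by
    ext σ
    rw [hA, Finset.mem_filter, Finset.mem_image]
    constructor
    · rintro ⟨-, ⟨hw, hc⟩, hseed⟩
      refine ⟨(plusLiftEquiv G Λ).symm ⟨σ, hw⟩, ?_, ?_⟩
      · have hσ : plusLift G Λ ((plusLiftEquiv G Λ).symm ⟨σ, hw⟩) = σ :=
          congrArg Subtype.val ((plusLiftEquiv G Λ).apply_symm_apply ⟨σ, hw⟩)
        rw [hA', Finset.mem_filter, hσ]
        exact ⟨Finset.mem_univ _, hc, hseed⟩
      · exact congrArg Subtype.val ((plusLiftEquiv G Λ).apply_symm_apply ⟨σ, hw⟩)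
    · rintro ⟨τ, hτ, rfl⟩
      rw [hA', Finset.mem_filter] at hτ
      exact ⟨Finset.mem_univ _, ⟨fun w hw ↦ plusLift_apply_of_notMem τ w hw, hτ.2.1⟩, hτ.2.2⟩
  have hAcard : #A = #A' := by rw [hAA', Finset.card_image_of_injective _ hinj]
  have hAle : (#A : ℝ) ≤ esCount G Λ η T ω := by
    rw [hAcard, esCount]
    exact_mod_cast Finset.card_le_card (fun τ hτ ↦ by
      rw [hA', Finset.mem_filter] at hτ
      rw [Finset.mem_filter]
      exact ⟨Finset.mem_univ _, hT τ hτ.2.1 hτ.2.2, hτ.2.1⟩)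
  -- the counting
  have hcount := card_filter_seeds_mul_pow_ge ω Sd hSd
  have hXpos : (0 : ℝ) < #X := by rw [hXcard]; positivity
  have h2 : (0 : ℝ) < (2 : ℝ) ^ #Sd := by positivity
  rw [colourFrac, ← hXcard, le_div_iff₀ hXpos, one_div_pow, div_mul_eq_mul_div, div_le_iff₀ h2, one_mul]
  calc (#X : ℝ) ≤ #A * (2 : ℝ) ^ #Sd := by exact_mod_cast hcount
    _ ≤ esCount G Λ η T ω * (2 : ℝ) ^ #Sd := by gcongr

/-- **The multi-seed coin flip of the Edwards–Sokal coupling** (Grimmett 2006, Thm. 1.13(b):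
conditionally on the bonds, the non-boundary clusters are coloured by independent fair coins): if
on a set `𝒲` of bond configurations there is a finite set `Sd(ω)` of at most `k` seeds, none
joined to the wired boundary by open edges, such that every compatible interior configuration
with spin `-1` at all seeds glues into `T`, then `μ^{η}_{Λ;β,0}(T) ≥ 2^{-k} φ(𝒲)`.
[cite: Grimmett2006, §1.4 Thm. 1.13] -/
theorem pow_half_mul_rcMeasure_real_le_isingMeasure_real {β : ℝ} (hβ : 0 ≤ β) {η : SpinConfig V}
    (hη : ∀ y ∈ outerBoundary G Λ, η y = 1) (hne : (outerBoundary G Λ).Nonempty)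
    {T : Set (SpinConfig V)} (hTm : MeasurableSet T) (k : ℕ)
    (𝒲 : Set (Percolation.BondConfig (ClosedV G Λ)))
    (h𝒲 : ∀ ω : Finset (Sym2 (ClosedV G Λ)), ω ⊆ esEdges G Λ →
      (↑ω : Percolation.BondConfig (ClosedV G Λ)) ∈ 𝒲 →
      ∃ Sd : Finset (ClosedV G Λ), #Sd ≤ k ∧
        (∀ s ∈ Sd, ¬ ∃ w ∈ esWired G Λ,
          (openGraph (↑ω : Percolation.BondConfig (ClosedV G Λ))).Reachable s w) ∧
        ∀ τ : Λ → ℤˣ, (∀ e ∈ ω, bondSpin (plusLift G Λ τ) e = 1) →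
          (∀ s ∈ Sd, plusLift G Λ τ s = -1) → glue Λ τ (.fixed η) ∈ T) :
    (1 / 2 : ℝ) ^ k * (rcMeasure (esGraph G Λ) (fkIsingParam β) 2 (esWired G Λ)).real 𝒲 ≤
      (isingMeasure G Λ β 0 (.fixed η)).real T := by
  classical
  have hp : fkIsingParam β ∈ Set.Icc (0 : ℝ) 1 := fkIsingParam_mem_Icc hβ
  have hET : (esGraph G Λ).edgeFinset = esEdges G Λ := edgeFinset_esGraph
  have hZ := rcPartitionFunction_pos (esGraph G Λ) hp two_pos (esWired G Λ)
  rw [isingMeasure_fixed_real_eq_edwardsSokal β hη hne hTm,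
    rcMeasure_real_apply (esGraph G Λ) hp two_pos (esWired G Λ) 𝒲, hET, Finset.mul_sum]
  refine Finset.sum_le_sum fun ω hω ↦ ?_
  have hwnn : 0 ≤ rcWeight (esGraph G Λ) (fkIsingParam β) 2 (esWired G Λ) ω /
      rcPartitionFunction (esGraph G Λ) (fkIsingParam β) 2 (esWired G Λ) :=
    div_nonneg (rcWeight_nonneg _ hp two_pos.le _ ω) hZ.le
  by_cases hmem : (↑ω : Percolation.BondConfig (ClosedV G Λ)) ∈ 𝒲
  · rw [if_pos hmem]
    obtain ⟨Sd, hk, hSd, hSdT⟩ := h𝒲 ω (Finset.mem_powerset.1 hω) hmem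
    have h := pow_half_le_colourFrac_of_seeds (η := η) (esWired_nonempty hne) Sd hSd hSdT
    have hk' : (1 / 2 : ℝ) ^ k ≤ (1 / 2 : ℝ) ^ #Sd :=
      pow_le_pow_of_le_one (by norm_num) (by norm_num) hk
    calc (1 / 2 : ℝ) ^ k * (rcWeight (esGraph G Λ) (fkIsingParam β) 2 (esWired G Λ) ω /
          rcPartitionFunction (esGraph G Λ) (fkIsingParam β) 2 (esWired G Λ))
        = rcWeight (esGraph G Λ) (fkIsingParam β) 2 (esWired G Λ) ω /
            rcPartitionFunction (esGraph G Λ) (fkIsingParam β) 2 (esWired G Λ) * (1 / 2 : ℝ) ^ k := by ring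
      _ ≤ _ := mul_le_mul_of_nonneg_left (hk'.trans h) hwnn
  · rw [if_neg hmem, mul_zero]
    exact mul_nonneg hwnn (colourFrac_nonneg η T ω)

end Seeds

/-! ### The lattice annulus `{n < ‖x - x₀‖_∞ < 29n}` and its Edwards–Sokal graph -/

section Annulus

variable (x₀ : Site 2) (n : ℕ)

/-- The lattice annulus `Λ = {z : n < ‖z - x₀‖_∞ < 29n}` (interior of the square annulus
`x₀ + S_{n,29n}`), the finite volume of the spin model. [cite: DuminilCopinSmirnov2012Clay, §6.1] -/
def annulusInterior : Finset (Site 2) :=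
  (Finset.Icc (x₀ - ![29 * (n : ℤ), 29 * n]) (x₀ + ![29 * (n : ℤ), 29 * n])).filter
    fun z ↦ (n : ℤ) < supLevel x₀ z ∧ supLevel x₀ z < 29 * n

variable {x₀ n}

/-- Membership in `annulusInterior`. [folklore] -/
theorem mem_annulusInterior {z : Site 2} :
    z ∈ annulusInterior x₀ n ↔ (n : ℤ) < supLevel x₀ z ∧ supLevel x₀ z < 29 * n := by
  rw [annulusInterior, Finset.mem_filter, and_iff_right_iff_imp]
  rintro ⟨-, h⟩
  unfold supLevel at h
  have h0 := abs_le.1 ((le_max_left |(z - x₀) 0| |(z - x₀) 1|).trans h.le)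
  have h1 := abs_le.1 ((le_max_right |(z - x₀) 0| |(z - x₀) 1|).trans h.le)
  simp only [Pi.sub_apply] at h0 h1
  rw [Finset.mem_Icc, Pi.le_def, Pi.le_def, Fin.forall_fin_two, Fin.forall_fin_two]
  simp only [Pi.sub_apply, Pi.add_apply, Matrix.cons_val_zero, Matrix.cons_val_one]
  omega

/-- A site of the exterior boundary of the annulus is at level `≤ n` or `≥ 29n`. [folklore] -/
theorem supLevel_of_notMem_annulusInterior {z : Site 2} (hz : z ∉ annulusInterior x₀ n) :
    supLevel x₀ z ≤ n ∨ 29 * (n : ℤ) ≤ supLevel x₀ z := by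
  rw [mem_annulusInterior, not_and_or, not_lt, not_lt] at hz
  exact hz

/-- The exterior boundary of the annulus is nonempty (`n ≥ 1`): `x₀ + (n, 0)` is adjacent to the
interior site `x₀ + (n + 1, 0)`. [folklore] -/
theorem outerBoundary_annulusInterior_nonempty (hn : 1 ≤ n) :
    (outerBoundary (zdGraph 2) (annulusInterior x₀ n)).Nonempty := by
  set z : Site 2 := x₀ + Pi.single (0 : Fin 2) (n : ℤ) with hz
  set y : Site 2 := z + Pi.single (0 : Fin 2) (1 : ℤ) with hy
  have hz0 : (z - x₀) 0 = n := by simp [hz]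
  have hz1 : (z - x₀) 1 = 0 := by simp [hz]
  have hy0 : (y - x₀) 0 = n + 1 := by simp [hy, hz]; ring
  have hy1 : (y - x₀) 1 = 0 := by simp [hy, hz]
  refine ⟨z, mem_outerBoundary_iff.2 ⟨fun h ↦ ?_, y, ?_, (zdGraph_adj_iff _ _).2 ⟨0, Or.inl rfl⟩⟩⟩
  · rw [mem_annulusInterior] at h
    unfold supLevel at h
    rw [hz0, hz1, abs_zero, Nat.abs_cast, max_eq_left (by positivity)] at h
    omega
  · rw [mem_annulusInterior]
    unfold supLevel
    rw [hy0, hy1, abs_zero, abs_of_nonneg (by positivity), max_eq_left (by positivity)]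
    constructor <;> omega

/-- The Edwards–Sokal graph of the annulus has lattice edges. [folklore] -/
theorem esGraph_annulus_lattice (u v : ClosedV (zdGraph 2) (annulusInterior x₀ n))
    (h : (esGraph (zdGraph 2) (annulusInterior x₀ n)).Adj u v) : (zdGraph 2).Adj u.1 v.1 :=
  (mk_mem_esEdges_iff.1 (esGraph_adj.1 h)).1

/-- Every site of the circuit annulus `6n ≤ ‖z - x₀‖_∞ ≤ 12n` is a vertex of the Edwards–Sokal
graph (`n ≥ 1`). [folklore] -/
theorem esGraph_annulus_fill (hn : 1 ≤ n) (z : Site 2) (h1 : 6 * (n : ℤ) ≤ supLevel x₀ z)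
    (h2 : supLevel x₀ z ≤ 12 * n) :
    ∃ v : ClosedV (zdGraph 2) (annulusInterior x₀ n), (closedVEmb (zdGraph 2) (annulusInterior x₀ n)) v = z :=
  ⟨⟨z, mem_closedVolume_of_mem (mem_annulusInterior.2 ⟨by omega, by omega⟩)⟩, rfl⟩

/-- Every lattice edge of the circuit annulus is an edge of the Edwards–Sokal graph. [folklore] -/
theorem esGraph_annulus_adj (hn : 1 ≤ n) (u v : ClosedV (zdGraph 2) (annulusInterior x₀ n))
    (hu1 : 6 * (n : ℤ) ≤ supLevel x₀ u.1) (hu2 : supLevel x₀ u.1 ≤ 12 * n)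
    (h : (zdGraph 2).Adj u.1 v.1) : (esGraph (zdGraph 2) (annulusInterior x₀ n)).Adj u v :=
  esGraph_adj.2 (mk_mem_esEdges_iff.2 ⟨h, Or.inl (mem_annulusInterior.2 ⟨by omega, by omega⟩)⟩)

/-- The wired vertices of the Edwards–Sokal graph are at level `≤ n` or `≥ 29n`. [folklore] -/
theorem esWired_annulus_level (v : ClosedV (zdGraph 2) (annulusInterior x₀ n))
    (hv : v ∈ esWired (zdGraph 2) (annulusInterior x₀ n)) :
    supLevel x₀ v.1 ≤ n ∨ 29 * (n : ℤ) ≤ supLevel x₀ v.1 :=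
  supLevel_of_notMem_annulusInterior hv

end Annulus

/-! ### The events: a `−` set blocking every `∗`-crossing, and a `+∗`-crossing -/

section Events

variable (x₀ : Site 2) (n : ℕ)

/-- A set of sites *blocks* the annulus `{6n ≤ ‖x - x₀‖_∞ ≤ 12n}` if every `∗`-walk of `ℤ²`
(king moves) from a site of level `< 6n` to a site of level `> 12n` visits it. (A `−` set that
blocks is the obstruction to `+∗`-crossings: Georgii–Higuchi 2000, §2, paths vs `∗`paths.)
[cite: GeorgiiHiguchi2000, §2 p. 4] -/
def StarBlocks (C : Set (Site 2)) : Prop :=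
  ∀ (a b : Site 2) (π : zdStarGraph.Walk a b), supLevel x₀ a < 6 * n → 12 * (n : ℤ) < supLevel x₀ b →
    ∃ z ∈ π.support, z ∈ C

/-- **The event "a set of `-1` spins of the annulus blocks every `∗`-crossing of
`{6n ≤ ‖x - x₀‖_∞ ≤ 12n}`"** (for instance a `−` circuit around the hole). [cite: GeorgiiHiguchi2000, §2 p. 4] -/
def minusStarBlocking : Set (SpinConfig (Site 2)) :=
  {σ | ∃ C : Finset (Site 2), C ⊆ annulusInterior x₀ n ∧ (∀ z ∈ C, σ z = -1) ∧ StarBlocks x₀ n ↑C}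

/-- **The event "a `+∗`-path crosses the annulus `{6n ≤ ‖x - x₀‖_∞ ≤ 12n}`"**: some finite set of
`+1` spins contains the support of a `∗`-walk from level `< 6n` to level `> 12n`.
[cite: GeorgiiHiguchi2000, §2 p. 4] -/
def plusStarCrossing : Set (SpinConfig (Site 2)) :=
  {σ | ∃ C : Finset (Site 2), (∀ z ∈ C, σ z = 1) ∧ ∃ (a b : Site 2) (π : zdStarGraph.Walk a b),
    supLevel x₀ a < 6 * n ∧ 12 * (n : ℤ) < supLevel x₀ b ∧ ∀ z ∈ π.support, z ∈ C}

variable {x₀ n}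

/-- A cylinder `{σ | σ = u on C}` is measurable. [folklore] -/
theorem measurableSet_forall_eq (C : Finset (Site 2)) (u : ℤˣ) :
    MeasurableSet {σ : SpinConfig (Site 2) | ∀ z ∈ C, σ z = u} := by
  have : {σ : SpinConfig (Site 2) | ∀ z ∈ C, σ z = u} = ⋂ z ∈ C, (fun σ : SpinConfig (Site 2) ↦ σ z) ⁻¹' {u} := by
    ext σ; simp
  rw [this]
  exact MeasurableSet.biInter C.countable_toSet fun z _ ↦ (measurable_pi_apply z) (measurableSet_singleton u)

/-- `minusStarBlocking` is measurable (a finite union of cylinders). [folklore] -/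
theorem measurableSet_minusStarBlocking : MeasurableSet (minusStarBlocking x₀ n) := by
  have : minusStarBlocking x₀ n = ⋃ C : Finset (Site 2), ⋃ (_ : C ⊆ annulusInterior x₀ n ∧ StarBlocks x₀ n ↑C),
      {σ : SpinConfig (Site 2) | ∀ z ∈ C, σ z = -1} := by
    ext σ
    simp only [minusStarBlocking, Set.mem_setOf_eq, Set.mem_iUnion, exists_prop]
    constructor
    · rintro ⟨C, h1, h2, h3⟩; exact ⟨C, ⟨h1, h3⟩, h2⟩
    · rintro ⟨C, ⟨h1, h3⟩, h2⟩; exact ⟨C, h1, h2, h3⟩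
  rw [this]
  exact MeasurableSet.iUnion fun C ↦ MeasurableSet.iUnion fun _ ↦ measurableSet_forall_eq C (-1)

/-- `plusStarCrossing` is measurable (a countable union of cylinders). [folklore] -/
theorem measurableSet_plusStarCrossing : MeasurableSet (plusStarCrossing x₀ n) := by
  have : plusStarCrossing x₀ n = ⋃ C : Finset (Site 2), ⋃ (_ : ∃ (a b : Site 2) (π : zdStarGraph.Walk a b),
      supLevel x₀ a < 6 * n ∧ 12 * (n : ℤ) < supLevel x₀ b ∧ ∀ z ∈ π.support, z ∈ C),
      {σ : SpinConfig (Site 2) | ∀ z ∈ C, σ z = 1} := by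
    ext σ
    simp only [plusStarCrossing, Set.mem_setOf_eq, Set.mem_iUnion, exists_prop]
    constructor
    · rintro ⟨C, h1, h2⟩; exact ⟨C, h2, h1⟩
    · rintro ⟨C, h2, h1⟩; exact ⟨C, h1, h2⟩
  rw [this]
  exact MeasurableSet.iUnion fun C ↦ MeasurableSet.iUnion fun _ ↦ measurableSet_forall_eq C 1

/-- `plusStarCrossing` is increasing. [folklore] -/
theorem isUpperSet_plusStarCrossing : IsUpperSet (plusStarCrossing x₀ n) := by
  rintro σ₁ σ₂ hle ⟨C, hC, a, b, π, ha, hb, hπ⟩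
  refine ⟨C, fun z hz ↦ ?_, a, b, π, ha, hb, hπ⟩
  have h1 := hC z hz
  have h2 : σ₁ z ≤ σ₂ z := hle z
  rw [h1] at h2
  exact le_antisymm (intUnits_le_one _) h2

/-- A `−` blocking set excludes every `+∗`-crossing (they would share a site). [cite: GeorgiiHiguchi2000, §2 p. 4] -/
theorem disjoint_minusStarBlocking_plusStarCrossing :
    Disjoint (minusStarBlocking x₀ n) (plusStarCrossing x₀ n) := by
  rw [Set.disjoint_left]
  rintro σ ⟨C, -, hC, hblock⟩ ⟨C', hC', a, b, π, ha, hb, hπ⟩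
  obtain ⟨z, hz, hzC⟩ := hblock a b π ha hb
  have h1 := hC z hzC
  have h2 := hC' z (hπ z hz)
  rw [h1] at h2
  exact absurd h2 (by decide)

end Events

/-! ### The main estimate -/

section Main

/-- `1 - e^{-2β_c} = p_sd(2)`. [cite: DuminilCopinSmirnov2012Clay, §3.2] -/
theorem fkIsingParam_criticalBetaTwo : fkIsingParam criticalBetaTwo = criticalFKIsingParam :=
  fkIsingParam_half_log

/-- **RSW for the critical Ising model: a `−` blocking set (circuit) under `+` boundary
conditions has probability bounded below, uniformly in the scale** (Chelkak–Duminil-Copin–Hongler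
2016, §5.3, the Edwards–Sokal transfer behind Cor. 1.7, combined with Duminil-Copin–Smirnov 2012,
Thm. 3.16 and Lemma 6.3, in the square annulus `x₀ + S_{n,29n}`): assuming `fkIsing_rsw` and
`fkIsing_annulusCrossing_le`, there is `c' > 0` such that for all `x₀ ∈ ℤ²`, `n ≥ 1` and every
boundary condition `η` equal to `+1` on the boundary squares `‖x - x₀‖_∞ ∈ {n, 29n}`, the
critical Ising measure `μ^{η}_{Λ;β_c,0}` of `Λ = {n < ‖x - x₀‖_∞ < 29n}` gives probability
`≥ c'` to `minusStarBlocking x₀ n`. [cite: ChelkakDuminilCopinHongler2016, §5.3, proof of Cor. 1.7] -/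
theorem exists_pos_le_isingMeasure_real_minusStarBlocking (h₁ : fkIsing_rsw)
    (h₂ : fkIsing_annulusCrossing_le) :
    ∃ c' : ℝ, 0 < c' ∧ ∀ (x₀ : Site 2) (n : ℕ), 1 ≤ n → ∀ η : SpinConfig (Site 2),
      (∀ y ∈ outerBoundary (zdGraph 2) (annulusInterior x₀ n), η y = 1) →
      c' ≤ (isingMeasure (zdGraph 2) (annulusInterior x₀ n) criticalBetaTwo 0 (.fixed η)).real
        (minusStarBlocking x₀ n) := by
  classical
  obtain ⟨c, hc1, hann⟩ := h₂
  obtain ⟨c₁, hc₁pos, hc₁⟩ := h₁.shift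
  obtain ⟨c₂, hc₂pos, hc₂⟩ := h₁.transpose_shift
  set c₀ := max c 0 with hc₀
  have hc₀0 : 0 ≤ c₀ := le_max_right _ _
  have hc₀1 : c₀ < 1 := max_lt hc1 one_pos
  have hm0 : 0 < min c₁ c₂ := lt_min hc₁pos hc₂pos
  refine ⟨(1 / 2 : ℝ) ^ 4 * ((1 - c₀) ^ 2 * (min c₁ c₂) ^ 4), by
    have : 0 < 1 - c₀ := sub_pos.2 hc₀1
    positivity, fun x₀ n hn η hη ↦ ?_⟩
  set Λ := annulusInterior x₀ n with hΛ
  set G := esGraph (zdGraph 2) Λ with hG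
  set ι := closedVEmb (zdGraph 2) Λ with hι
  have hβ : 0 ≤ criticalBetaTwo := criticalBetaTwo_pos.le
  have hne : (outerBoundary (zdGraph 2) Λ).Nonempty := outerBoundary_annulusInterior_nonempty hn
  have hGlat : ∀ u v, G.Adj u v → (zdGraph 2).Adj (ι u) (ι v) := fun u v h ↦ esGraph_annulus_lattice u v h
  have hfill : ∀ z : Site 2, 6 * (n : ℤ) ≤ supLevel x₀ z → supLevel x₀ z ≤ 12 * n → ∃ v, ι v = z :=
    fun z h1 h2 ↦ esGraph_annulus_fill hn z h1 h2
  have hadj : ∀ u v, 6 * (n : ℤ) ≤ supLevel x₀ (ι u) → supLevel x₀ (ι u) ≤ 12 * n →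
      6 * (n : ℤ) ≤ supLevel x₀ (ι v) → supLevel x₀ (ι v) ≤ 12 * n →
      (zdGraph 2).Adj (ι u) (ι v) → G.Adj u v :=
    fun u v hu1 hu2 _ _ h ↦ esGraph_annulus_adj hn u v hu1 hu2 h
  have hB : ∀ v ∈ esWired (zdGraph 2) Λ, supLevel x₀ (ι v) ≤ n ∨ 29 * (n : ℤ) ≤ supLevel x₀ (ι v) :=
    fun v hv ↦ esWired_annulus_level v hv
  -- the FK side
  have hW := le_rcMeasure_real_insulatedCircuitEvent G ι x₀ hc₀0 hc₀1.le
    (fun m hm ↦ (hann m hm).trans (le_max_left _ _)) hm0.le hc₁ hc₂ hGlat hn hfill hadj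
    (esWired (zdGraph 2) Λ) hB
  -- the coin flip with the four seeds
  have key := pow_half_mul_rcMeasure_real_le_isingMeasure_real (G := zdGraph 2) (Λ := Λ) hβ hη hne
    (T := minusStarBlocking x₀ n) measurableSet_minusStarBlocking 4 (insulatedCircuitEvent G ι x₀ n) ?_
  · rw [fkIsingParam_criticalBetaTwo] at key
    exact le_trans (mul_le_mul_of_nonneg_left hW (by positivity)) key
  intro ω hωE hmem
  have hωE' : (↑ω : Percolation.BondConfig (ClosedV (zdGraph 2) Λ)) ⊆ G.edgeSet := by
    intro e he
    have he' : e ∈ esEdges (zdGraph 2) Λ := hωE (Finset.mem_coe.1 he)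
    induction e using Sym2.ind with
    | h a b => exact (mem_edgeSet G).2 (esGraph_adj.2 he')
  obtain ⟨s, havoid, hblock⟩ := insulatedCircuitEvent_seeds G ι x₀ hGlat hn (esWired (zdGraph 2) Λ) hB hωE' hmem
  refine ⟨Finset.univ.image fun p : Fin 2 × ℤˣ ↦ s p.1 p.2, ?_, ?_, ?_⟩
  · calc #(Finset.univ.image fun p : Fin 2 × ℤˣ ↦ s p.1 p.2) ≤ #(Finset.univ : Finset (Fin 2 × ℤˣ)) :=
          Finset.card_image_le
      _ = 4 := by rw [Finset.card_univ, Fintype.card_prod, Fintype.card_fin, Fintype.card_units_int]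
  · intro s' hs'
    obtain ⟨p, -, rfl⟩ := Finset.mem_image.1 hs'
    exact havoid p.1 p.2
  · intro τ hc hseed
    -- the clusters of the seeds, read in `ℤ²`
    refine ⟨Λ.filter fun z ↦ ∃ v : ClosedV (zdGraph 2) Λ, v.1 = z ∧ ∃ (i : Fin 2) (ε : ℤˣ),
      (openGraph (↑ω : Percolation.BondConfig (ClosedV (zdGraph 2) Λ))).Reachable (s i ε) v,
      Finset.filter_subset _ _, fun z hz ↦ ?_, fun a b π ha hb ↦ ?_⟩
    · rw [Finset.mem_filter] at hz
      obtain ⟨hzΛ, v, rfl, i, ε, hr⟩ := hz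
      have hs : plusLift (zdGraph 2) Λ τ (s i ε) = -1 :=
        hseed (s i ε) (Finset.mem_image.2 ⟨(i, ε), Finset.mem_univ _, rfl⟩)
      rw [glue_fixed_apply_closedV hη τ v]
      exact plusLift_eq_neg_one_of_reachable hc hs hr
    · obtain ⟨z, hz, i, ε, v, rfl, hr⟩ := hblock a b π ha hb
      refine ⟨ι v, hz, ?_⟩
      rw [Finset.coe_filter, Set.mem_setOf_eq]
      refine ⟨?_, v, rfl, i, ε, hr⟩
      by_contra hv
      exact havoid i ε ⟨v, hv, hr⟩

/-- Monotonicity in the boundary condition for increasing events (from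
`integral_isingMeasure_fixed_mono` with an indicator). [cite: FriedliVelenik2017, Exercise 3.13] -/
theorem isingMeasure_fixed_real_mono_of_isUpperSet {V : Type*} [DecidableEq V] (G : SimpleGraph V)
    [G.LocallyFinite] {β : ℝ} (hβ : 0 ≤ β) (Λ : Finset V) {η₁ η₂ : SpinConfig V} (hη : η₁ ≤ η₂)
    {A : Set (SpinConfig V)} (hA : IsUpperSet A) (hAm : MeasurableSet A) :
    (isingMeasure G Λ β 0 (.fixed η₁)).real A ≤ (isingMeasure G Λ β 0 (.fixed η₂)).real A := by
  have hmono : Monotone (A.indicator (1 : SpinConfig V → ℝ)) := by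
    intro σ₁ σ₂ hle
    by_cases h : σ₁ ∈ A
    · rw [Set.indicator_of_mem h, Set.indicator_of_mem (hA hle h)]
      exact le_rfl
    · rw [Set.indicator_of_notMem h]
      exact Set.indicator_nonneg (fun _ _ ↦ zero_le_one) _
  have h := integral_isingMeasure_fixed_mono G hβ Λ 0 hη hmono ((measurable_const).indicator hAm)
  rwa [integral_indicator_one hAm, integral_indicator_one hAm] at h

/-- **Uniform upper bound for `+∗`-crossings of a square annulus, whatever the boundary
condition** (the "worst boundary condition" bound behind Condition G for spin-Ising interfaces:
Kemppainen–Smirnov 2017, Rem. 2.10 and §4; CDHKS 2014, Rem. 4): assuming `fkIsing_rsw` and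
`fkIsing_annulusCrossing_le`, there is `c' > 0` such that for all `x₀`, `n ≥ 1` and EVERY fixed
boundary condition `η`, the critical Ising measure of `{n < ‖x - x₀‖_∞ < 29n}` gives probability
`≤ 1 - c'` to a `+∗`-crossing of `{6n ≤ ‖x - x₀‖_∞ ≤ 12n}` (monotonicity in `η ≤ +1`, then the
`−` blocking set). By the global spin flip the same holds for `−∗`-crossings.
[cite: KemppainenSmirnov2017, Rem. 2.10] -/
theorem isingMeasure_fixed_real_plusStarCrossing_le (h₁ : fkIsing_rsw) (h₂ : fkIsing_annulusCrossing_le) :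
    ∃ c' : ℝ, 0 < c' ∧ ∀ (x₀ : Site 2) (n : ℕ), 1 ≤ n → ∀ η : SpinConfig (Site 2),
      (isingMeasure (zdGraph 2) (annulusInterior x₀ n) criticalBetaTwo 0 (.fixed η)).real
        (plusStarCrossing x₀ n) ≤ 1 - c' := by
  obtain ⟨c', hc', h⟩ := exists_pos_le_isingMeasure_real_minusStarBlocking h₁ h₂
  refine ⟨c', hc', fun x₀ n hn η ↦ ?_⟩
  set μ₁ := isingMeasure (zdGraph 2) (annulusInterior x₀ n) criticalBetaTwo 0 (.fixed 1) with hμ₁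
  have hmono := isingMeasure_fixed_real_mono_of_isUpperSet (zdGraph 2) criticalBetaTwo_pos.le
    (annulusInterior x₀ n) (η₁ := η) (η₂ := 1) (fun v ↦ intUnits_le_one (η v))
    (A := plusStarCrossing x₀ n) isUpperSet_plusStarCrossing measurableSet_plusStarCrossing
  refine hmono.trans ?_
  have hT := h x₀ n hn 1 (fun _ _ ↦ rfl)
  have hsum : μ₁.real (minusStarBlocking x₀ n) + μ₁.real (plusStarCrossing x₀ n) ≤ 1 := by
    rw [← measureReal_union disjoint_minusStarBlocking_plusStarCrossing measurableSet_plusStarCrossing]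
    exact measureReal_le_one
  linarith

end Main

end Literature.Probability.LatticeModels

end
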